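import Summits.NavierStokesRegularity.NavierStokesRegularity.Theses.PalasekTowerBreakdown
import Summits.NavierStokesRegularity.FluidComputer.PalasekTowerFaceNecessity
import Summits.NavierStokesRegularity.FluidComputer.PalasekTowerFaceScaling
import Summits.NavierStokesRegularity.FluidComputer.PalasekTowerFaceNumbers

/-!
# `EpisodeBase` BY NAME, in pure numbers: the crux forces near-extremal UNIT Navier–Stokes flows to exist
# (crux idea `universal-face-constants`, stmt-NavierStokesRegularity-19179)

Cell `ns-blowup`, seat `ns-palasek-19179-p2` (g2; holder of record of the crux `EpisodeBase` of the route
`PalasekTowerBreakdown`, item stmt-NavierStokesRegularity-19179, line `slot`). Companion of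
`PalasekTowerBreakdownEpisodeBaseFaces.lean` (meters/doors by name; not imported — this file builds on the route-independent
`FluidComputer/PalasekTowerFaceNecessity.lean` doors directly), using the parabolic scale invariance of the two bound
predicates (`FluidComputer/PalasekTowerFaceScaling.lean`) and the certified face numbers
(`FluidComputer/PalasekTowerFaceNumbers.lean`). The METERS of the crux idea card `universal-face-constants` (lens `dual`,
19179 evidence #53/#58) become EXISTENTIAL statements about unit-normalised flows (`ν = 1`, speed scale `1`, start time `0`),
with every register constant replaced by a certified decimal:

* `palasekTowerBreakdown_exists_unit_speed_flow_of_episodeBase`: `EpisodeBase` ⇒ there is a finite-energy classical forced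
  NS flow on `[0, windowAnch] × ℝ³` (`windowAnch ∈ (325.7, 325.9)`) with speed `≤ 1` everywhere at time `0`, speed `≤ 3.429`
  throughout, force `≤ 5.48 · 10⁻⁷` throughout, and a point where the speed at time `windowAnch` EXCEEDS `2.055` — the flow
  more than doubles its maximal speed, essentially unforced, in `≈ 325.8` viscous times;
* `palasekTowerBreakdown_exists_unit_gradient_flow_of_episodeBase`: `EpisodeBase` ⇒ there is such a flow on
  `[0, windowCeil 0] × ℝ³` (`windowCeil 0 ∈ (3825, 3829)`) with speed `≤ 1` and force `≤ 1.37 · 10⁻⁸` throughout and a point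
  where `‖∇u(windowCeil 0)‖ > 0.0577`;
* the parametric forms behind them (`…_of_lt_floorAnch`, `…_of_lt_gradFloorCeil`), and the monotonicity of the bound
  predicates in the running cap and the force budget (`SpeedAmplificationBound.of_le_cap`, `….of_le_force`,
  `GradientProductionBound.of_le_force`).

LABEL: E–C typing (KERNEL, proofs only, by name). WHAT THIS IS NOT: not Navier–Stokes evidence — implications FROM the OPEN crux;
no such flow is constructed or claimed to exist; nothing about blow-up. HELPER for 19179 (`--supports`), closes nothing. The
numbers are the honest METER every primal design for 19179 must beat (HOLDER-CENSUS-19179 §2/§5).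

References: S. Palasek, arXiv:2605.13827 §3.3–§4 [cite: Palasek2026ElementaryModel, §4]; J. Leray, Acta Math. 63 (1934) §20
[cite: Leray1934, §20].
-/

noncomputable section

-- `Summit.<Summit>.<Problem>` is the tree's mandated summit-side namespace (CONVENTIONS §2); for this
-- single-conjunct summit the two coincide, so the duplicate is deliberate.
set_option linter.dupNamespace false

namespace Summit.NavierStokesRegularity.NavierStokesRegularity.Theorems

open Set MeasureTheory
open scoped ENNReal
open Literature.Analysis.FluidPDE
open Summit.NavierStokesRegularity.FluidComputer.PalasekTowerClayBridge
open Summit.NavierStokesRegularity.FluidComputer.PalasekTowerClayBridge.UniversalFace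

/-! ## §1 Monotonicity of the bound predicates in the running cap and the force budget -/

/-- A speed-amplification bound valid under a LARGER running cap `c'` implies the one under a smaller cap `c ≤ c'` (fewer
flows to control). [folklore] -/
theorem _root_.Summit.NavierStokesRegularity.FluidComputer.PalasekTowerClayBridge.UniversalFace.SpeedAmplificationBound.of_le_cap
    {s c c' φ a : ℝ} (h : SpeedAmplificationBound s c' φ a) (hc : c ≤ c') : SpeedAmplificationBound s c φ a := by
  intro t₀ T m f u p hT hm hs hcl hen hfo hst hrun x
  exact h t₀ T m f u p hT hm hs hcl hen hfo hst
    (fun t ht y => (hrun t ht y).trans (mul_le_mul_of_nonneg_right hc hm.le)) x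

/-- A speed-amplification bound valid under a LARGER force budget `φ'` implies the one under `φ ≤ φ'`. [folklore] -/
theorem _root_.Summit.NavierStokesRegularity.FluidComputer.PalasekTowerClayBridge.UniversalFace.SpeedAmplificationBound.of_le_force
    {s c φ φ' a : ℝ} (h : SpeedAmplificationBound s c φ' a) (hφ : φ ≤ φ') : SpeedAmplificationBound s c φ a := by
  intro t₀ T m f u p hT hm hs hcl hen hfo hst hrun x
  exact h t₀ T m f u p hT hm hs hcl hen
    (fun t ht y => (hfo t ht y).trans (mul_le_mul_of_nonneg_right hφ (by positivity))) hst hrun x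

/-- A gradient-production bound valid under a LARGER force budget `φ'` implies the one under `φ ≤ φ'`. [folklore] -/
theorem _root_.Summit.NavierStokesRegularity.FluidComputer.PalasekTowerClayBridge.UniversalFace.GradientProductionBound.of_le_force
    {s φ φ' κ : ℝ} (h : GradientProductionBound s φ' κ) (hφ : φ ≤ φ') : GradientProductionBound s φ κ := by
  intro t₀ T M f u p hT hM hs hcl hen hfo hsp x
  exact h t₀ T M f u p hT hM hs hcl hen
    (fun t ht y => (hfo t ht y).trans (mul_le_mul_of_nonneg_right hφ (by positivity))) hsp x

/-! ## §2 The meters as existence of near-extremal unit flows (parametric forms) -/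

/-- **EXISTENTIAL METER S₀ᴬ**: if the crux holds, then for every `a < floorAnch = Y₁/Y₀` and every force budget
`φ ≥ forceAnch` there is a finite-energy classical forced Navier–Stokes flow at unit viscosity on `[0, windowAnch] × ℝ³` with
speed `≤ 1` everywhere at time `0`, speed `≤ runAnch` and force `≤ φ` throughout, and a point where the speed at time
`windowAnch` exceeds `a` (the anchored unit form of the level-`1` stage, via `speedAmplificationBound_iff_unit`).
[cite: Palasek2026ElementaryModel, §3.3] -/
theorem palasekTowerBreakdown_exists_unit_speed_flow_of_lt_floorAnch
    (h : Summit.NavierStokesRegularity.NavierStokesRegularity.Theses.PalasekTowerBreakdown.EpisodeBase) {a φ : ℝ}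
    (hφ : forceAnch ≤ φ) (ha : a < floorAnch) :
    ∃ (f u : ℝ → EuclideanSpace ℝ (Fin 3) → EuclideanSpace ℝ (Fin 3)) (p : ℝ → EuclideanSpace ℝ (Fin 3) → ℝ),
      IsClassicalNSSolutionOn (Icc 0 windowAnch) 1 f u p ∧
      (∃ C : ℝ≥0∞, C < ⊤ ∧ ∀ t ∈ Icc 0 windowAnch, ∫⁻ x, ‖u t x‖ₑ ^ 2 ≤ C) ∧
      (∀ t ∈ Icc 0 windowAnch, ∀ x, ‖f t x‖ ≤ φ) ∧
      (∀ x, ‖u 0 x‖ ≤ 1) ∧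
      (∀ t ∈ Icc 0 windowAnch, ∀ x, ‖u t x‖ ≤ runAnch) ∧
      ∃ x, a < ‖u windowAnch x‖ := by
  have hs : 0 < windowAnch := by linarith [windowAnch_bounds.1]
  by_contra hne
  refine not_episodeBaseG_of_speedAmplificationBound_anchored ?_ hφ ha h
  rw [speedAmplificationBound_iff_unit hs]
  intro f u p h1 h2 h3 h4 h5 x
  by_contra hx
  exact hne ⟨f, u, p, h1, h2, h3, h4, h5, x, lt_of_not_ge hx⟩

/-- **EXISTENTIAL METER G₀**: if the crux holds, then for every `κ < gradFloorCeil 0` and every force budget `φ ≥ forceCeil 0`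
there is a finite-energy classical forced Navier–Stokes flow at unit viscosity on `[0, windowCeil 0] × ℝ³` with speed `≤ 1`
and force `≤ φ` throughout and a point where `‖∇u(windowCeil 0)‖ > κ` (via `gradientProductionBound_iff_unit`).
[cite: Palasek2026ElementaryModel, §3.3] -/
theorem palasekTowerBreakdown_exists_unit_gradient_flow_of_lt_gradFloorCeil
    (h : Summit.NavierStokesRegularity.NavierStokesRegularity.Theses.PalasekTowerBreakdown.EpisodeBase) {κ φ : ℝ}
    (hφ : forceCeil 0 ≤ φ) (hκ : κ < gradFloorCeil 0) :
    ∃ (f u : ℝ → EuclideanSpace ℝ (Fin 3) → EuclideanSpace ℝ (Fin 3)) (p : ℝ → EuclideanSpace ℝ (Fin 3) → ℝ),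
      IsClassicalNSSolutionOn (Icc 0 (windowCeil 0)) 1 f u p ∧
      (∃ C : ℝ≥0∞, C < ⊤ ∧ ∀ t ∈ Icc 0 (windowCeil 0), ∫⁻ x, ‖u t x‖ₑ ^ 2 ≤ C) ∧
      (∀ t ∈ Icc 0 (windowCeil 0), ∀ x, ‖f t x‖ ≤ φ) ∧
      (∀ t ∈ Icc 0 (windowCeil 0), ∀ x, ‖u t x‖ ≤ 1) ∧
      ∃ x, κ < ‖fderiv ℝ (u (windowCeil 0)) x‖ := by
  have hs : 0 < windowCeil 0 := by linarith [windowCeil_zero_bounds.1]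
  by_contra hne
  refine not_episodeBaseG_of_gradientProductionBound ?_ hφ hκ h
  rw [gradientProductionBound_iff_unit hs]
  intro f u p h1 h2 h3 h4 x
  by_contra hx
  exact hne ⟨f, u, p, h1, h2, h3, h4, x, lt_of_not_ge hx⟩

/-! ## §3 The meters in certified decimals -/

/-- **THE SPEED METER OF THE CRUX, IN PURE NUMBERS.** If `EpisodeBase` holds, then some finite-energy classical forced
Navier–Stokes flow at unit viscosity on `[0, windowAnch] × ℝ³` — `windowAnch ∈ (325.7, 325.9)` viscous times — has speed
`≤ 1` everywhere at time `0`, speed `≤ 3.429` and force `≤ 5.48 · 10⁻⁷` throughout, and a point where its speed at time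
`windowAnch` EXCEEDS `2.055`: an essentially unforced unit flow that more than doubles its maximal speed in `≈ 325.8`
viscous times under a `3.43` running cap. (Monotonicity in the cap and the force budget reduces to the parametric meter at
`a = 2.055 < floorAnch`, `φ = 5.48e-7 ≥ forceAnch`.) [cite: Palasek2026ElementaryModel, §3.3] -/
theorem palasekTowerBreakdown_exists_unit_speed_flow_of_episodeBase
    (h : Summit.NavierStokesRegularity.NavierStokesRegularity.Theses.PalasekTowerBreakdown.EpisodeBase) :
    ∃ (f u : ℝ → EuclideanSpace ℝ (Fin 3) → EuclideanSpace ℝ (Fin 3)) (p : ℝ → EuclideanSpace ℝ (Fin 3) → ℝ),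
      IsClassicalNSSolutionOn (Icc 0 windowAnch) 1 f u p ∧
      (∃ C : ℝ≥0∞, C < ⊤ ∧ ∀ t ∈ Icc 0 windowAnch, ∫⁻ x, ‖u t x‖ₑ ^ 2 ≤ C) ∧
      (∀ t ∈ Icc 0 windowAnch, ∀ x, ‖f t x‖ ≤ 548 / 10 ^ 9) ∧
      (∀ x, ‖u 0 x‖ ≤ 1) ∧
      (∀ t ∈ Icc 0 windowAnch, ∀ x, ‖u t x‖ ≤ 3.429) ∧
      ∃ x, 2.055 < ‖u windowAnch x‖ := by
  have hs : 0 < windowAnch := by linarith [windowAnch_bounds.1]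
  have hφ : forceAnch ≤ 548 / 10 ^ 9 := forceAnch_bounds.2.le
  have ha : (2.055 : ℝ) < floorAnch := floorAnch_bounds.1
  have hc : runAnch ≤ 3.429 := runAnch_bounds.2.le
  by_contra hne
  refine not_episodeBaseG_of_speedAmplificationBound_anchored (a := 2.055) (φ := 548 / 10 ^ 9)
    ?_ hφ ha h
  refine SpeedAmplificationBound.of_le_cap ?_ hc
  rw [speedAmplificationBound_iff_unit hs]
  intro f u p h1 h2 h3 h4 h5 x
  by_contra hx
  exact hne ⟨f, u, p, h1, h2, h3, h4, h5, x, lt_of_not_ge hx⟩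

/-- **THE GRADIENT METER OF THE CRUX, IN PURE NUMBERS.** If `EpisodeBase` holds, then some finite-energy classical forced
Navier–Stokes flow at unit viscosity on `[0, windowCeil 0] × ℝ³` — `windowCeil 0 ∈ (3825, 3829)` — has speed `≤ 1` and force
`≤ 1.37 · 10⁻⁸` throughout and a point where `‖∇u(windowCeil 0)‖ > 0.0577` (operator norm): gradient production `κ ≥ 0.0577`
under a unit speed cap over `≈ 3826` viscous times. [cite: Palasek2026ElementaryModel, §3.3] -/
theorem palasekTowerBreakdown_exists_unit_gradient_flow_of_episodeBase
    (h : Summit.NavierStokesRegularity.NavierStokesRegularity.Theses.PalasekTowerBreakdown.EpisodeBase) :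
    ∃ (f u : ℝ → EuclideanSpace ℝ (Fin 3) → EuclideanSpace ℝ (Fin 3)) (p : ℝ → EuclideanSpace ℝ (Fin 3) → ℝ),
      IsClassicalNSSolutionOn (Icc 0 (windowCeil 0)) 1 f u p ∧
      (∃ C : ℝ≥0∞, C < ⊤ ∧ ∀ t ∈ Icc 0 (windowCeil 0), ∫⁻ x, ‖u t x‖ₑ ^ 2 ≤ C) ∧
      (∀ t ∈ Icc 0 (windowCeil 0), ∀ x, ‖f t x‖ ≤ 137 / 10 ^ 10) ∧
      (∀ t ∈ Icc 0 (windowCeil 0), ∀ x, ‖u t x‖ ≤ 1) ∧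
      ∃ x, 0.0577 < ‖fderiv ℝ (u (windowCeil 0)) x‖ := by
  have hφ : forceCeil 0 ≤ 137 / 10 ^ 10 := forceCeil_zero_bounds.2.le
  have hκ : (0.0577 : ℝ) < gradFloorCeil 0 := gradFloorCeil_zero_bounds.1
  exact palasekTowerBreakdown_exists_unit_gradient_flow_of_lt_gradFloorCeil h hφ hκ

end Summit.NavierStokesRegularity.NavierStokesRegularity.Theorems

end
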